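import Mathlib
import HarnessLib
import Summits.ValiantsHypothesis.ValiantsHypothesis.Theorems.MonotoneRestorationOrbitRestorationQPSmlRestoration
import Summits.ValiantsHypothesis.ValiantsHypothesis.Theorems.MonotoneRestorationOrbitRestorationQPTranspose

/-!
# The ROW-set-multilinear `ΣΠΣ` stratum of A_∞ (transpose twin of `SmlRestoration.colSml_restoration`)

Route MonotoneRestoration, crux `OrbitRestorationQP` (stmt-ValiantsHypothesis-18293), line `depth-three-rung`, registered stub
`stub_sigmaPiSigmaValue` (A_∞).  Namespace `Summit.ValiantsHypothesis.ValiantsHypothesis.Theorems.SmlRestoration`.  Definition-free.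

`…SmlRestoration.lean` proves that a MATRIX-SYMMETRIC family whose members have COLUMN-set-multilinear `ΣΠΣ` circuits
`f n = Σ_{t<s} Π_{b} (Σ_a α_{t,b,a} x_{(a,b)})` with `s ≤ n^c + c` product gates is quasi-polynomially orbit-restorable.
Transposition `x_{(a,b)} ↦ x_{(b,a)}` commutes with the diagonal action of `Sym (Fin n)` and costs a flat `+3` in the
restoration constant (`Transpose.qpOrbitRestorable_of_transpose`), and it maps a ROW-set-multilinear expression
`Σ_{t<s} Π_{a} (Σ_b α_{t,a,b} x_{(a,b)})` to a column-set-multilinear one with the same coefficient table.  Hence: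

* `rename_swap_rowSml` — the transpose of a row-set-multilinear `ΣΠΣ` expression is the column-set-multilinear expression
  with the same coefficients;
* `isMatrixSymmetric_transpose` — the transposed family of a matrix-symmetric family is matrix-symmetric;
* `rowSml_restoration` — **THE ROW-SET-MULTILINEAR STRATUM OF A_∞**: a matrix-symmetric family with row-set-multilinear
  `ΣΠΣ` circuits of at most `n^c + c` product gates is quasi-polynomially orbit-restorable;
* `sml_restoration` — both strata in one statement (at each level the circuit may be column- OR row-set-multilinear).

Honest label: bookkeeping over two landed theorems (transport of structure); a stratum of the off-path sub-rung A_∞; the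
stub itself (all of `PDClass 1`), the crux and VP ≠ VNP are not touched. [folklore]
-/

noncomputable section

open scoped Classical

-- `Summit.ValiantsHypothesis.ValiantsHypothesis.…` is the tree's single-conjunct layout (Sub = Summit).
set_option linter.dupNamespace false

namespace Summit.ValiantsHypothesis.ValiantsHypothesis.Theorems.SmlRestoration

open MvPolynomial Finset Equiv OrbitRestorationQPDepthThreeRung

/-- **Transpose of a row-set-multilinear expression.**  `(Σ_t Π_a Σ_b α_{t,a,b} x_{(a,b)})ᵀ = Σ_t Π_b Σ_a α_{t,b,a} x_{(a,b)}`: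
the column-set-multilinear expression with the same coefficient table. [folklore] -/
theorem rename_swap_rowSml {n s : ℕ} (α : Fin s → Fin n → Fin n → ℂ) :
    rename (Prod.swap : Fin n × Fin n → Fin n × Fin n)
        (∑ t : Fin s, ∏ a : Fin n, ∑ b : Fin n, C (α t a b) * X (a, b) : MvPolynomial (Fin n × Fin n) ℂ) =
      ∑ t : Fin s, ∏ b : Fin n, ∑ a : Fin n, C (α t b a) * X (a, b) := by
  simp only [map_sum, map_prod, map_mul, rename_C, rename_X, Prod.swap_prod_mk]

/-- The transposed family of a matrix-symmetric family is matrix-symmetric. [folklore] -/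
theorem isMatrixSymmetric_transpose {f : (n : ℕ) → MvPolynomial (Fin n × Fin n) ℂ} (hsym : IsMatrixSymmetric f) :
    IsMatrixSymmetric fun n => rename (Prod.swap : Fin n × Fin n → Fin n × Fin n) (f n) :=
  fun n σ τ => Transpose.matrixSymmetric_transpose (hsym n) σ τ

/-- **THE ROW-SET-MULTILINEAR STRATUM OF A_∞.**  A matrix-symmetric family with row-set-multilinear `ΣΠΣ` circuits
`f n = Σ_{t<s} Π_a (Σ_b α_{t,a,b} x_{(a,b)})` of at most `n^c + c` product gates is quasi-polynomially orbit-restorable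
(transpose of `colSml_restoration`, constant `+3`). [folklore] -/
theorem rowSml_restoration :
    ∀ f : (n : ℕ) → MvPolynomial (Fin n × Fin n) ℂ, IsMatrixSymmetric f →
      (∃ c : ℕ, ∀ n : ℕ, ∃ (s : ℕ) (α : Fin s → Fin n → Fin n → ℂ), s ≤ n ^ c + c ∧
        f n = ∑ t : Fin s, ∏ a : Fin n, ∑ b : Fin n, C (α t a b) * X (a, b)) →
      ∃ c' : ℕ, ∀ n : ℕ, QPOrbitRestorable c' n (f n) := by
  intro f hsym ⟨c, hcirc⟩
  have hT : ∃ c₁ : ℕ, ∀ n : ℕ, ∃ (s : ℕ) (α : Fin s → Fin n → Fin n → ℂ), s ≤ n ^ c₁ + c₁ ∧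
      rename (Prod.swap : Fin n × Fin n → Fin n × Fin n) (f n) =
        ∑ t : Fin s, ∏ b : Fin n, ∑ a : Fin n, C (α t b a) * X (a, b) := by
    refine ⟨c, fun n => ?_⟩
    obtain ⟨s, α, hs, hf⟩ := hcirc n
    exact ⟨s, α, hs, by rw [hf, rename_swap_rowSml]⟩
  obtain ⟨c', hc'⟩ := colSml_restoration _ (isMatrixSymmetric_transpose hsym) hT
  exact ⟨c' + 3, fun n => Transpose.qpOrbitRestorable_of_transpose (hc' n)⟩

/-- **THE SET-MULTILINEAR STRATUM, BOTH SIDES.**  A matrix-symmetric family each of whose members has a column- OR a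
row-set-multilinear `ΣΠΣ` circuit with at most `n^c + c` product gates (the side may depend on the level) is
quasi-polynomially orbit-restorable. [folklore] -/
theorem sml_restoration :
    ∀ f : (n : ℕ) → MvPolynomial (Fin n × Fin n) ℂ, IsMatrixSymmetric f →
      (∃ c : ℕ, ∀ n : ℕ, ∃ (s : ℕ) (α : Fin s → Fin n → Fin n → ℂ), s ≤ n ^ c + c ∧
        (f n = ∑ t : Fin s, ∏ b : Fin n, ∑ a : Fin n, C (α t b a) * X (a, b) ∨
         f n = ∑ t : Fin s, ∏ a : Fin n, ∑ b : Fin n, C (α t a b) * X (a, b))) →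
      ∃ c' : ℕ, ∀ n : ℕ, QPOrbitRestorable c' n (f n) := by
  intro f hsym ⟨c, hcirc⟩
  -- split the family into its column-sml levels and its row-sml levels (zero elsewhere); both pieces are matrix-symmetric
  have hcol : ∀ n, ∃ (s : ℕ) (α : Fin s → Fin n → Fin n → ℂ), s ≤ n ^ c + c ∧
      (if ∃ (s : ℕ) (α : Fin s → Fin n → Fin n → ℂ), s ≤ n ^ c + c ∧
          f n = ∑ t : Fin s, ∏ b : Fin n, ∑ a : Fin n, C (α t b a) * X (a, b) then f n else 0) =
        ∑ t : Fin s, ∏ b : Fin n, ∑ a : Fin n, C (α t b a) * X (a, b) := by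
    intro n
    by_cases h : ∃ (s : ℕ) (α : Fin s → Fin n → Fin n → ℂ), s ≤ n ^ c + c ∧
        f n = ∑ t : Fin s, ∏ b : Fin n, ∑ a : Fin n, C (α t b a) * X (a, b)
    · obtain ⟨s, α, hs, hf⟩ := h
      exact ⟨s, α, hs, by rw [if_pos ⟨s, α, hs, hf⟩, hf]⟩
    · refine ⟨0, fun _ _ _ => 0, Nat.zero_le _, ?_⟩
      rw [if_neg h]; simp
  have hrow : ∀ n, ∃ (s : ℕ) (α : Fin s → Fin n → Fin n → ℂ), s ≤ n ^ c + c ∧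
      (if ∃ (s : ℕ) (α : Fin s → Fin n → Fin n → ℂ), s ≤ n ^ c + c ∧
          f n = ∑ t : Fin s, ∏ b : Fin n, ∑ a : Fin n, C (α t b a) * X (a, b) then (0 : MvPolynomial (Fin n × Fin n) ℂ)
        else f n) =
        ∑ t : Fin s, ∏ a : Fin n, ∑ b : Fin n, C (α t a b) * X (a, b) := by
    intro n
    by_cases h : ∃ (s : ℕ) (α : Fin s → Fin n → Fin n → ℂ), s ≤ n ^ c + c ∧
        f n = ∑ t : Fin s, ∏ b : Fin n, ∑ a : Fin n, C (α t b a) * X (a, b)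
    · refine ⟨0, fun _ _ _ => 0, Nat.zero_le _, ?_⟩
      rw [if_pos h]; simp
    · obtain ⟨s, α, hs, hf⟩ := hcirc n
      rcases hf with hf | hf
      · exact absurd ⟨s, α, hs, hf⟩ h
      · exact ⟨s, α, hs, by rw [if_neg h, hf]⟩
  have hsymIf : ∀ (P : ℕ → Prop), IsMatrixSymmetric fun n => if P n then f n else 0 := by
    intro P n σ τ
    by_cases h : P n
    · simp only [if_pos h]; exact hsym n σ τ
    · simp only [if_neg h, map_zero]
  have hsymIf' : ∀ (P : ℕ → Prop), IsMatrixSymmetric fun n => if P n then (0 : MvPolynomial (Fin n × Fin n) ℂ) else f n := by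
    intro P n σ τ
    by_cases h : P n
    · simp only [if_pos h, map_zero]
    · simp only [if_neg h]; exact hsym n σ τ
  obtain ⟨c₁, hc₁⟩ := colSml_restoration _ (hsymIf _) ⟨c, hcol⟩
  obtain ⟨c₂, hc₂⟩ := rowSml_restoration _ (hsymIf' _) ⟨c, hrow⟩
  refine ⟨max c₁ c₂, fun n => ?_⟩
  by_cases h : ∃ (s : ℕ) (α : Fin s → Fin n → Fin n → ℂ), s ≤ n ^ c + c ∧
      f n = ∑ t : Fin s, ∏ b : Fin n, ∑ a : Fin n, C (α t b a) * X (a, b)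
  · have := hc₁ n
    simp only [if_pos h] at this
    exact Restorable.qpOrbitRestorable_mono (le_max_left _ _) this
  · have := hc₂ n
    simp only [if_neg h] at this
    exact Restorable.qpOrbitRestorable_mono (le_max_right _ _) this

end Summit.ValiantsHypothesis.ValiantsHypothesis.Theorems.SmlRestoration

end
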